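import Literature.Probability.Percolation.MacroscopicInterfaceLoop
import HarnessLib

/-!
# An open cluster and a closed site are separated by an interface loop (winding numbers)

Topic: Probability / Percolation.  The deterministic planar input of "an open crossing and a
closed crossing of the same quad have a cluster interface between them" (F. Camia,
C. M. Newman, Comm. Math. Phys. 268 (2006), §5, proof of Thm 3 / Lemma 5.2: the percolation
exploration between a blue and a yellow path; Bollobás–Riordan, *Percolation* (2006), Ch. 7
§7.2.3), in the winding-number form of `SiteInterfaceWinding.lean` (no Jordan curve theorem):

* `IsSiteInterfaceLoop.loopWind_eq_of_pathIn_of_mem`, `…_of_not_mem` — the winding number of an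
  interface polygon is constant along open site paths and along closed site paths;
* `exists_isSiteInterfaceLoop_loopWind_eq` — **separation**: if the open cluster `C` of an open
  site `u₀` is finite and `v₀` is a closed site, there is an interface loop `w` of `ω`, all of
  whose left (open) sites lie in `C`, such that the closed polygon of `w` at mesh `δ > 0` winds
  `m` times about every site of `C` and `m - 1` times about every site joined to `v₀` by closed
  sites (`m` = the winding number about `u₀`).  Proof: follow any lattice walk from `u₀` to `v₀`;
  at its last exit from `C` it crosses an edge `a ∼ b`, `a ∈ C`, `b ∉ C` (so `b` is closed), and
  then runs to `v₀` off `C`.  The interface loop of the finite configuration `C` through the dart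
  `a → b` (`exists_isSiteInterfaceLoop_of_adj`) is an interface loop of `ω` (a right site in `ω`
  would be an open neighbour of a site of `C`); its winding number jumps by `1` across `a ∼ b`
  (`loopWind_leftPt_sub_loopWind_rightPt`), is constant on `C` (edges inside `C` are not crossed)
  and constant along the rest of the walk and along closed paths (edges off `C` are not crossed:
  every crossed edge has its left site in `C`).

## References

* F. Camia, C. M. Newman, Comm. Math. Phys. 268 (2006), §5 [CamiaNewman2006].
* B. Bollobás, O. Riordan, *Percolation* (2006), Ch. 7 §7.2.3 [BollobasRiordan2006].
-/

noncomputable section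

open Set Metric

namespace Literature.Probability.Percolation

open LatticeModels

variable {ω : SiteConfig (Site 2)} {f₀ : HexVertex} {w : hexGraph.Walk f₀ f₀}

/-! ### Winding numbers are constant along monochromatic paths -/

/-- **Transport along a path avoiding the left sites.** If no site of `A` is a left site of the
interface loop `w`, the closed polygon of `w` winds equally about the two ends of every site path
inside `A` (no edge with both ends in `A` is crossed). [folklore] -/
theorem IsSiteInterfaceLoop.loopWind_eq_of_pathIn_of_lv_not_mem (hw : IsSiteInterfaceLoop ω w)
    {δ : ℝ} (hδ : 0 < δ) {A : Set (Site 2)} (hA : ∀ i < w.length, hw.lv i ∉ A) {x y : Site 2}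
    (h : PathIn triGraph A x y) : loopWind δ w (triMeshPoint δ x) = loopWind δ w (triMeshPoint δ y) := by
  obtain ⟨W, hW⟩ := h.exists_walk
  have key := hw.loopWind_triMeshPoint_eq_of_chain hδ W.getVert W.length
    (fun k hk ↦ Or.inr (W.adj_getVert_succ hk)) fun k _ i hi ↦
      ⟨fun hh ↦ hA i hi (hh.1 ▸ hW _ (W.getVert_mem_support k)),
        fun hh ↦ hA i hi (hh.2 ▸ hW _ (W.getVert_mem_support (k + 1)))⟩
  rwa [W.getVert_zero, W.getVert_length] at key

/-- **Transport along a path avoiding the right sites** (symmetric form). [folklore] -/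
theorem IsSiteInterfaceLoop.loopWind_eq_of_pathIn_of_rv_not_mem (hw : IsSiteInterfaceLoop ω w)
    {δ : ℝ} (hδ : 0 < δ) {A : Set (Site 2)} (hA : ∀ i < w.length, hw.rv i ∉ A) {x y : Site 2}
    (h : PathIn triGraph A x y) : loopWind δ w (triMeshPoint δ x) = loopWind δ w (triMeshPoint δ y) := by
  obtain ⟨W, hW⟩ := h.exists_walk
  have key := hw.loopWind_triMeshPoint_eq_of_chain hδ W.getVert W.length
    (fun k hk ↦ Or.inr (W.adj_getVert_succ hk)) fun k _ i hi ↦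
      ⟨fun hh ↦ hA i hi (hh.2 ▸ hW _ (W.getVert_mem_support (k + 1))),
        fun hh ↦ hA i hi (hh.1 ▸ hW _ (W.getVert_mem_support k))⟩
  rwa [W.getVert_zero, W.getVert_length] at key

/-- **The winding number is constant along open paths**: the right site of every dart is closed.
[cite: CamiaNewman2006, §4] -/
theorem IsSiteInterfaceLoop.loopWind_eq_of_pathIn_of_mem (hw : IsSiteInterfaceLoop ω w) {δ : ℝ}
    (hδ : 0 < δ) {x y : Site 2} (h : PathIn triGraph ω x y) :
    loopWind δ w (triMeshPoint δ x) = loopWind δ w (triMeshPoint δ y) :=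
  hw.loopWind_eq_of_pathIn_of_rv_not_mem hδ (fun _ hi ↦ hw.rv_not_mem hi) h

/-- **The winding number is constant along closed paths**: the left site of every dart is open.
[cite: CamiaNewman2006, §4] -/
theorem IsSiteInterfaceLoop.loopWind_eq_of_pathIn_of_not_mem (hw : IsSiteInterfaceLoop ω w) {δ : ℝ}
    (hδ : 0 < δ) {x y : Site 2} (h : PathIn triGraph ωᶜ x y) :
    loopWind δ w (triMeshPoint δ x) = loopWind δ w (triMeshPoint δ y) :=
  hw.loopWind_eq_of_pathIn_of_lv_not_mem hδ (A := ωᶜ) (fun _ hi hh ↦ hh (hw.lv_mem hi)) h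

/-! ### An interface loop of a cluster is an interface loop of the configuration -/

/-- **An interface loop of an open cluster is an interface loop of the whole configuration.**
If `C ⊆ ω` is closed under open neighbours (an open site adjacent to a site of `C` lies in `C`),
every interface loop of the configuration `C` is an interface loop of `ω`. [folklore] -/
theorem IsSiteInterfaceLoop.of_cluster {C : Set (Site 2)} (hC : C ⊆ ω)
    (hcl : ∀ x ∈ C, ∀ y ∈ ω, triGraph.Adj x y → y ∈ C) (hw : IsSiteInterfaceLoop C w) :
    IsSiteInterfaceLoop ω w := by
  refine ⟨hw.isCycle, fun d hd ↦ ?_⟩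
  obtain ⟨e, he, h1, h2⟩ := hw.2 d hd
  exact ⟨e, he, hC h1, fun h ↦ h2 (hcl _ h1 _ h e.adj)⟩

/-! ### Separation of an open cluster from a closed site -/

/-- **Separation by an interface loop (winding form).** Let `u₀` be an open site whose open
cluster `C = {x | u₀ ↔ x through open sites}` is finite, `v₀` a closed site and `δ > 0`. Then some
interface loop `w` of `ω` has all its left sites in `C`, winds equally (say `m` times) about all
sites of `C`, and winds `m - 1` times about every site joined to `v₀` by a path of closed sites.
In particular the interface polygon separates `C` from the closed cluster of `v₀`
(Camia–Newman 2006, §5; Bollobás–Riordan 2006, Ch. 7 §7.2.3). [cite: CamiaNewman2006, §5] -/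
theorem exists_isSiteInterfaceLoop_loopWind_eq {δ : ℝ} (hδ : 0 < δ) {u₀ v₀ : Site 2}
    (hfin : {x | PathIn triGraph ω u₀ x}.Finite) (hu₀ : u₀ ∈ ω) (hv₀ : v₀ ∉ ω) :
    ∃ (F : HexVertex) (w : hexGraph.Walk F F) (hw : IsSiteInterfaceLoop ω w),
      (∀ i < w.length, PathIn triGraph ω u₀ (hw.lv i)) ∧
      (∀ x, PathIn triGraph ω u₀ x →
        loopWind δ w (triMeshPoint δ x) = loopWind δ w (triMeshPoint δ u₀)) ∧
      (∀ y, PathIn triGraph ωᶜ v₀ y →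
        loopWind δ w (triMeshPoint δ y) = loopWind δ w (triMeshPoint δ u₀) - 1) := by
  classical
  set C : Set (Site 2) := {x | PathIn triGraph ω u₀ x} with hC_def
  have hCω : C ⊆ ω := fun x hx ↦ hx.right_mem
  have hcl : ∀ x ∈ C, ∀ y ∈ ω, triGraph.Adj x y → y ∈ C := fun x hx y hy hxy ↦
    PathIn.tail hx hxy hy
  have hu₀C : u₀ ∈ C := PathIn.refl hu₀
  have hv₀C : v₀ ∉ C := fun h ↦ hv₀ (hCω h)
  -- a lattice walk from `u₀` to `v₀` and its last exit from `C`
  obtain ⟨W⟩ := (zdGraph_reachable u₀ v₀).mono zdGraph_le_triGraph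
  have hW : PathIn triGraph univ u₀ v₀ := PathIn.of_walk W fun _ _ ↦ mem_univ _
  obtain ⟨a, b, haC, -, hbC, hab, htail⟩ := hW.last_exit hu₀C hv₀C
  have hbω : b ∉ ω := fun hb ↦ hbC (hcl a haC b hb hab)
  -- the interface loop of the cluster through the dart `a → b`
  obtain ⟨F, w, hwC, hfaces⟩ := exists_isSiteInterfaceLoop_of_adj hfin hab haC hbC
  have hw : IsSiteInterfaceLoop ω w := hwC.of_cluster hCω hcl
  have hlen : 0 < w.length := by have := hw.isCycle.three_le_length; omega
  have hlr : hw.lv 0 = a ∧ hw.rv 0 = b := by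
    obtain ⟨h', hfaces', -, -⟩ := hw.dart_spec hlen
    exact eq_of_triEdgeFaces_eq h' hab (hfaces'.trans hfaces.symm)
  -- the left sites are in `C`
  have hlv : ∀ i < w.length, PathIn triGraph ω u₀ (hw.lv i) := fun i hi ↦
    haC.trans (hlr.1 ▸ hw.pathIn_lv hi)
  refine ⟨F, w, hw, hlv, fun x hx ↦ (hw.loopWind_eq_of_pathIn_of_mem hδ hx).symm, fun y hy ↦ ?_⟩
  -- windings: `u₀ ~ a`, jump across `a ∼ b`, `b ~ v₀` off `C`, `v₀ ~ y` through closed sites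
  have h1 : loopWind δ w (triMeshPoint δ u₀) = loopWind δ w (triMeshPoint δ a) :=
    hw.loopWind_eq_of_pathIn_of_mem hδ haC
  have h2 : loopWind δ w (triMeshPoint δ a) - loopWind δ w (triMeshPoint δ b) = 1 := by
    rw [← hlr.1, ← hlr.2]
    exact hw.loopWind_leftPt_sub_loopWind_rightPt hδ hlen
  have h3 : loopWind δ w (triMeshPoint δ b) = loopWind δ w (triMeshPoint δ v₀) :=
    hw.loopWind_eq_of_pathIn_of_lv_not_mem hδ (A := univ \ C) (fun i hi hh ↦ hh.2 (hlv i hi)) htail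
  have h4 : loopWind δ w (triMeshPoint δ v₀) = loopWind δ w (triMeshPoint δ y) :=
    hw.loopWind_eq_of_pathIn_of_not_mem hδ hy
  omega

/-- **Separation, inequality form**: with `w` as in `exists_isSiteInterfaceLoop_loopWind_eq`, the
winding numbers about the sites of the open cluster of `u₀` and about the sites of the closed
cluster of `v₀` differ. [cite: CamiaNewman2006, §5] -/
theorem exists_isSiteInterfaceLoop_loopWind_ne {δ : ℝ} (hδ : 0 < δ) {u₀ v₀ : Site 2}
    (hfin : {x | PathIn triGraph ω u₀ x}.Finite) (hu₀ : u₀ ∈ ω) (hv₀ : v₀ ∉ ω) :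
    ∃ (F : HexVertex) (w : hexGraph.Walk F F) (hw : IsSiteInterfaceLoop ω w),
      (∀ i < w.length, PathIn triGraph ω u₀ (hw.lv i)) ∧
      ∀ x y, PathIn triGraph ω u₀ x → PathIn triGraph ωᶜ v₀ y →
        loopWind δ w (triMeshPoint δ x) ≠ loopWind δ w (triMeshPoint δ y) := by
  obtain ⟨F, w, hw, hlv, hC, hD⟩ := exists_isSiteInterfaceLoop_loopWind_eq hδ hfin hu₀ hv₀
  refine ⟨F, w, hw, hlv, fun x y hx hy ↦ ?_⟩
  rw [hC x hx, hD y hy]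
  omega

end Literature.Probability.Percolation
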